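import Mathlib
import HarnessLib

/-!
# Convergence in distribution on `ℝ` IS convergence of distribution functions at the continuity
# points of the limit: `Tₙ ⇒ Z ↔ (P(Tₙ ≤ x) → P(Z ≤ x)` at every continuity point `x` of
# `x ↦ P(Z ≤ x))` — the sharp form of `Scoring/CdfConvergence`

HONEST FRAMING: exact (Metropolis-corrected) sampling algorithms for lattice gauge theory;
figures of merit are autocorrelation/cost numbers at stated couplings and volumes; no
continuum-physics claim.

Venture `LatticeQCDFlow` (cell pub-lqcd), topic `Scoring`; FANOUT row 4 (`s0-u1-b`, rung S0-B).
`Scoring/CdfConvergence.tendstoInDistribution_of_tendsto_cdf` assumed convergence of the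
distribution functions at EVERY point, which is only available when the limit law has no atoms;
limit laws of counting statistics (acceptance counts at fixed `n`, rounded charges, discrete
bootstrap distributions) do have atoms.  This file proves the textbook equivalence on `ℝ`:
(i) the distribution function `x ↦ P(Z ≤ x)` is monotone, so its continuity points are dense
(countably many discontinuities); (ii) at a continuity point the limit law has no atom, hence
`(−∞, x]` is a continuity set and the portmanteau theorem gives `P(Tₙ ≤ x) → P(Z ≤ x)`
(**`tendsto_cdf_of_tendstoInDistribution`**); (iii) conversely, convergence at all continuity
points gives `Tₙ ⇒ Z` by Mathlib's π-system criterion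
`IsPiSystem.tendsto_probabilityMeasure_of_tendsto_of_mem` applied to the half-open intervals
with endpoints in the dense set of continuity points
(**`tendstoInDistribution_of_tendsto_cdf_of_continuousAt`**); together
**`tendstoInDistribution_iff_tendsto_cdf`**.  NEW WORK of the cell (classical — e.g. Billingsley,
*Probability and Measure*, Thm 25.8 in prose; our formalisation, Mathlib has the portmanteau and
π-system criteria but not this corollary); no definition; nothing cited as a fact.

## Content

* `monotone_measureReal_le`, `dense_continuousAt_measureReal_le`, `measureReal_le_eq_cdf`,
  `measure_map_singleton_eq_zero_of_continuousAt`;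
* **`tendsto_cdf_of_tendstoInDistribution`**, **`tendstoInDistribution_of_tendsto_cdf_of_continuousAt`**,
  **`tendstoInDistribution_iff_tendsto_cdf`**.

NOT CLAIMED: random vectors (`ℝᵈ`, where distribution functions are the wrong object); general
filters (sequences `ℕ` only, as everywhere in the packet).
-/

noncomputable section

namespace Summit.Ventures.LatticeQCDFlow.Scoring.CardConsistency

open MeasureTheory ProbabilityTheory Filter Set
open scoped Topology ENNReal

variable {Ω : Type*} [MeasurableSpace Ω] {P : Measure Ω} [IsProbabilityMeasure P]
variable {Ω' : Type*} [MeasurableSpace Ω'] {P' : Measure Ω'} [IsProbabilityMeasure P']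

/-! ## §1 The distribution function of the limit -/

/-- `x ↦ P'(Z ≤ x)` is monotone. [folklore] -/
theorem monotone_measureReal_le (Z : Ω' → ℝ) : Monotone fun x => P'.real {ω' | Z ω' ≤ x} :=
  fun _ _ hxy => measureReal_mono (fun ω' (h : Z ω' ≤ _) => h.trans hxy) (measure_ne_top _ _)

/-- **Continuity points of a distribution function are dense** (a monotone function has countably
many discontinuities). [folklore] -/
theorem dense_continuousAt_measureReal_le (Z : Ω' → ℝ) :
    Dense {x : ℝ | ContinuousAt (fun y => P'.real {ω' | Z ω' ≤ y}) x} := by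
  have h := (monotone_measureReal_le (P' := P') Z).countable_not_continuousAt.dense_compl ℝ
  simpa only [compl_setOf, not_not] using h

/-- `P'(Z ≤ x) = cdf (P' ∘ Z⁻¹) x`. [folklore] -/
theorem measureReal_le_eq_cdf {Z : Ω' → ℝ} (hZ : AEMeasurable Z P') (x : ℝ) :
    P'.real {ω' | Z ω' ≤ x} = cdf (P'.map Z) x := by
  haveI := Measure.isProbabilityMeasure_map (μ := P') hZ
  rw [cdf_eq_real, measureReal_def, measureReal_def,
    Measure.map_apply_of_aemeasurable hZ measurableSet_Iic]
  rfl

/-- **No atom at a continuity point**: if `x ↦ P'(Z ≤ x)` is continuous at `x` then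
`P'(Z = x) = 0`. [folklore] (Stieltjes: the atom is the jump `F(x) − F(x−)`) -/
theorem measure_map_singleton_eq_zero_of_continuousAt {Z : Ω' → ℝ} (hZ : AEMeasurable Z P')
    {x : ℝ} (hx : ContinuousAt (fun y => P'.real {ω' | Z ω' ≤ y}) x) : (P'.map Z) {x} = 0 := by
  haveI := Measure.isProbabilityMeasure_map (μ := P') hZ
  have e : (fun y => P'.real {ω' | Z ω' ≤ y}) = fun y => cdf (P'.map Z) y :=
    funext fun y => measureReal_le_eq_cdf hZ y
  rw [e] at hx
  have hleft : Function.leftLim (cdf (P'.map Z)) x = cdf (P'.map Z) x :=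
    ((monotone_cdf (P'.map Z)).continuousWithinAt_Iio_iff_leftLim_eq).1 hx.continuousWithinAt
  have h1 := (cdf (P'.map Z)).measure_singleton x
  rw [measure_cdf] at h1
  rw [h1, hleft, sub_self, ENNReal.ofReal_zero]

/-! ## §2 Limit in distribution ⇒ distribution functions converge at continuity points -/

/-- **`Tₙ ⇒ Z` ⇒ `P(Tₙ ≤ x) → P'(Z ≤ x)` at every continuity point `x` of `x ↦ P'(Z ≤ x)`.**
[ours] (portmanteau for the continuity set `(−∞, x]`) -/
theorem tendsto_cdf_of_tendstoInDistribution {T : ℕ → Ω → ℝ} {Z : Ω' → ℝ}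
    (h : TendstoInDistribution T atTop Z (fun _ => P) P') {x : ℝ}
    (hx : ContinuousAt (fun y => P'.real {ω' | Z ω' ≤ y}) x) :
    Tendsto (fun n => P.real {ω | T n ω ≤ x}) atTop (𝓝 (P'.real {ω' | Z ω' ≤ x})) := by
  have hfr : (P'.map Z) (frontier (Iic x)) = 0 := by
    rw [frontier_Iic]
    exact measure_map_singleton_eq_zero_of_continuousAt h.aemeasurable_limit hx
  have key := ProbabilityMeasure.tendsto_measure_of_null_frontier_of_tendsto' h.tendsto
    (E := Iic x) (by simpa only [ProbabilityMeasure.coe_mk] using hfr)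
  simp only [ProbabilityMeasure.coe_mk] at key
  rw [Measure.map_apply_of_aemeasurable h.aemeasurable_limit measurableSet_Iic] at key
  have key' : Tendsto (fun n => P (T n ⁻¹' Iic x)) atTop (𝓝 (P' (Z ⁻¹' Iic x))) := by
    refine key.congr fun n => ?_
    rw [Measure.map_apply_of_aemeasurable (h.forall_aemeasurable n) measurableSet_Iic]
  simp only [measureReal_def]
  exact (ENNReal.tendsto_toReal (measure_ne_top P' _)).comp key'

/-! ## §3 The sharp converse and the equivalence -/

/-- **CONVERGENCE OF DISTRIBUTION FUNCTIONS AT THE CONTINUITY POINTS OF THE LIMIT IMPLIES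
CONVERGENCE IN DISTRIBUTION.**  Real statistics `Tₙ` (a.e.-measurable) on `(Ω, P)`, `Z` on
`(Ω', P')`; if `P(Tₙ ≤ x) → P'(Z ≤ x)` for every continuity point `x` of `x ↦ P'(Z ≤ x)`, then
`Tₙ ⇒ Z`. [ours] (π-system of half-open intervals with endpoints in the dense set of
continuity points) -/
theorem tendstoInDistribution_of_tendsto_cdf_of_continuousAt {T : ℕ → Ω → ℝ} {Z : Ω' → ℝ}
    (hT : ∀ n, AEMeasurable (T n) P) (hZ : AEMeasurable Z P')
    (h : ∀ x : ℝ, ContinuousAt (fun y => P'.real {ω' | Z ω' ≤ y}) x →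
      Tendsto (fun n => P.real {ω | T n ω ≤ x}) atTop (𝓝 (P'.real {ω' | Z ω' ≤ x}))) :
    TendstoInDistribution T atTop Z (fun _ => P) P' := by
  refine ⟨hT, hZ, ?_⟩
  set C : Set ℝ := {x : ℝ | ContinuousAt (fun y => P'.real {ω' | Z ω' ≤ y}) x} with hC
  have hdense : Dense C := dense_continuousAt_measureReal_le Z
  -- the π-system of half-open intervals with endpoints in `C`
  have hS : IsPiSystem {S : Set ℝ | ∃ i j : C, (i : ℝ) < j ∧ Ioc (i : ℝ) (j : ℝ) = S} :=
    isPiSystem_Ioc (Subtype.val : C → ℝ) (Subtype.val : C → ℝ)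
  refine hS.tendsto_probabilityMeasure_of_tendsto_of_mem (fun s hs => ?_) (fun u hu x hx => ?_)
    (fun s hs => ?_)
  · obtain ⟨i, j, -, rfl⟩ := hs
    exact measurableSet_Ioc
  · -- small neighbourhoods: `(a, b] ∈ 𝓝 x` inside `u`, with `a < x < b` continuity points
    obtain ⟨ε, hε, hball⟩ := Metric.isOpen_iff.1 hu x hx
    obtain ⟨a, haC, ha⟩ := hdense.exists_mem_open isOpen_Ioo
      (nonempty_Ioo.mpr (by linarith : x - ε / 2 < x))
    obtain ⟨b, hbC, hb⟩ := hdense.exists_mem_open isOpen_Ioo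
      (nonempty_Ioo.mpr (by linarith : x < x + ε / 2))
    refine ⟨Ioc a b, ⟨⟨a, haC⟩, ⟨b, hbC⟩, by simp only; linarith [ha.2, hb.1], rfl⟩, ?_, ?_⟩
    · exact mem_of_superset (Ioo_mem_nhds ha.2 hb.1) Ioo_subset_Ioc_self
    · intro y hy
      apply hball
      rw [Metric.mem_ball, Real.dist_eq, abs_lt]
      constructor <;> linarith [hy.1, hy.2, ha.1, hb.2]
  · -- convergence on `(a, b]`: differences of distribution-function values at continuity points
    obtain ⟨i, j, hab, rfl⟩ := hs
    rw [← ENNReal.tendsto_coe]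
    simp only [ProbabilityMeasure.ennreal_coeFn_eq_coeFn_toMeasure, ProbabilityMeasure.coe_mk]
    rw [← ENNReal.tendsto_toReal_iff (fun n => measure_ne_top _ _) (measure_ne_top _ _)]
    have e : ∀ n, ((P.map (T n)) (Ioc (i : ℝ) j)).toReal
        = P.real {ω | T n ω ≤ j} - P.real {ω | T n ω ≤ i} := fun n => by
      rw [← measureReal_def, ← Iic_sdiff_Iic, measureReal_sdiff (Iic_subset_Iic.2 hab.le)
        measurableSet_Iic, measureReal_def, measureReal_def,
        Measure.map_apply_of_aemeasurable (hT n) measurableSet_Iic,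
        Measure.map_apply_of_aemeasurable (hT n) measurableSet_Iic]
      rfl
    have eZ : ((P'.map Z) (Ioc (i : ℝ) j)).toReal
        = P'.real {ω' | Z ω' ≤ j} - P'.real {ω' | Z ω' ≤ i} := by
      rw [← measureReal_def, ← Iic_sdiff_Iic, measureReal_sdiff (Iic_subset_Iic.2 hab.le)
        measurableSet_Iic, measureReal_def, measureReal_def,
        Measure.map_apply_of_aemeasurable hZ measurableSet_Iic,
        Measure.map_apply_of_aemeasurable hZ measurableSet_Iic]
      rfl
    simp_rw [e, eZ]
    exact (h j j.2).sub (h i i.2)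

/-- **THE EQUIVALENCE.**  For a.e.-measurable real statistics, `Tₙ ⇒ Z` if and only if
`P(Tₙ ≤ x) → P'(Z ≤ x)` at every continuity point `x` of `x ↦ P'(Z ≤ x)`. [ours] -/
theorem tendstoInDistribution_iff_tendsto_cdf {T : ℕ → Ω → ℝ} {Z : Ω' → ℝ}
    (hT : ∀ n, AEMeasurable (T n) P) (hZ : AEMeasurable Z P') :
    TendstoInDistribution T atTop Z (fun _ => P) P' ↔
      ∀ x : ℝ, ContinuousAt (fun y => P'.real {ω' | Z ω' ≤ y}) x →
        Tendsto (fun n => P.real {ω | T n ω ≤ x}) atTop (𝓝 (P'.real {ω' | Z ω' ≤ x})) :=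
  ⟨fun h _ hx => tendsto_cdf_of_tendstoInDistribution h hx,
    tendstoInDistribution_of_tendsto_cdf_of_continuousAt hT hZ⟩

end Summit.Ventures.LatticeQCDFlow.Scoring.CardConsistency

end
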